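import Literature.NumberTheory.PAdicHodge.TateH1Reduction
import Literature.NumberTheory.PAdicHodge.TateTwistCoboundary
import Literature.NumberTheory.PAdicHodge.TateSenCocycles
import Literature.NumberTheory.PAdicHodge.TateCocycleTransferContinuous
import Literature.NumberTheory.PAdicHodge.TateLogCyclotomicClass
import HarnessLib

/-!
# Tate 1967 §3.3 Theorem 2: `H¹_cont(Gal(F̄/ℚ_p), ℂ_F(χ^j)) = 0` and `H¹_cont(Γ_F, ℂ_F(χ^j)) = 0` for `j ≠ 0`,
# GRANTED (TS1)

Assembly of tree files: `TateTwistCoboundary` (edix-p2: on `X = \widehat{K_∞}` the twisted operator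
`y ↦ χ(γ)^j γ y − y` is BIJECTIVE for `j ≠ 0`, `TateTrace.exists_unique_chi_zpow_mul_gen_smul_sub_eq`),
`TateH1Reduction` (edix-p1: `H = Gal(F̄/K_∞)` is normal in `G₀ = Gal(F̄/K₀)` with abelian quotient; values of
cocycles trivial on `H` lie in `X = ℂ_F^H`), `TateSenCocycles` (edix-p4: `H¹_cont(ker χ, ℂ_F) = 0` GRANTED the
Tate–Sen axiom (TS1), `TateSen.baseKer_exists_eq_smul_sub_of_TS1`) and `TateCocycleTransferContinuous` (edix-p2:
the transfer `Γ_F ≤ G₀`, `TateDescent.exists_eq_twistedCoboundary_of_base`). Notation: `K₀ = PadicBase F p hp ≅ ℚ_p`,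
`G₀ = BaseGaloisGroup hp`, weight `u_j(g) = ι(χ(g))^j = ι (W g)^j ∈ ℂ_F`, twisted cocycle
`C(g g') = C(g) + u_j(g) · g C(g')`, twisted coboundary `(∂_j b)(g) = u_j(g) · g b − b`.

* `TateTwistedH1.mem_X`, `twisted_smul_sub_eq` — for a twisted cocycle trivial on `H`: values in `X`, and
  **`u_j(γ) γ C(g) − C(g) = u_j(g) g C(γ) − C(γ)`** (commutators lie in `H`).
* `TateTwistedH1.eq_tcoboundary_of_forall_smul_zeta` — **UNCONDITIONAL core**: a twisted cocycle (`j ≠ 0`)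
  trivial on `H` IS a twisted coboundary `∂_j y`, `y ∈ X`: solve `u_j(γ) γ y − y = C(γ)` in `X` (bijectivity),
  then `C − ∂_j y` vanishes at `γ` and on `H`, so by the displayed identity every value is a fixed vector of the
  twisted `γ`-operator on `X`, hence `0` (injectivity). No continuity, no normalised trace needed.
* **`TateTwistedH1.exists_eq_tcoboundary_of_TS1`** — every CONTINUOUS twisted cocycle `C : G₀ → ℂ_F(χ^j)`,
  `j ≠ 0`, is a twisted coboundary, GRANTED (TS1) (first `C|_{ker χ} = ∂b₀` by edix-p4's theorem; `H ⊆ ker χ`).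
* `TateTwistedH1.base_hG_of_TS1` — the same in the input shape of the transfer (any `ℓ`, coefficient `a = 0`).
* **`TateTwistedH1.exists_eq_tcoboundary_absGalois_of_TS1`** — `H¹_cont(Γ_F, ℂ_F(χ_F^j)) = 0` for `j ≠ 0`,
  GRANTED (TS1): every continuous `χ_F^j`-twisted cocycle `c : Γ_F → ℂ_F` is `σ ↦ u_j(σ) σ B − B`.
* `TateTwistedH1.ι_W_toBase` — the weight at `toBase σ` is `χ_F(σ)` read in `ℂ_F` (`χ(toBase σ) = χ_F(σ)`).

CONDITIONAL only on (TS1) (hypothesis `hTS`, Berger–Colmez (TS1) for `ℂ_F` = Tate 1967 §3.2 Prop. 9); the core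
is unconditional. No named fact, no `sorry`, no definition.

## References
* J. Tate, *p-divisible groups* (1967), §3.3 Theorem 2. [Tate1967]
* J.-M. Fontaine, Y. Ouyang, *Theory of p-adic Galois representations*, §3.2 Prop. 3.17, Thm. 3.21. [FontaineOuyang2022]
* L. Berger, P. Colmez, *Familles de représentations de de Rham et monodromie p-adique* (2008), §3–4. [BergerColmez2008]
-/

noncomputable section

open ValuativeRel Field UniformSpace Filter Topology

namespace Literature.NumberTheory.PAdicHodge

open Literature.NumberTheory.GaloisRepresentations
open Literature.NumberTheory.GaloisRepresentations.IsNonarchimedeanLocalField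
open CyclotomicTower TateTrace

variable {F : Type} [Field F] [ValuativeRel F] [TopologicalSpace F] [IsNonarchimedeanLocalField F]
  [CharZero F] {p : ℕ} [Fact p.Prime] (hp : valuation F p < 1)

namespace TateTwistedH1

variable {j : ℤ} {C : BaseGaloisGroup hp → CompletedAlgClosure F}

/-! ### The weight `u_j = ι(χ)^j` -/

/-- `u_j(h) = 1` for `h ∈ H` (`χ(h) = 1`). [cite: Tate1967, §3.3] -/
theorem ι_W_zpow_eq_one_of_forall_smul_zeta {h : BaseGaloisGroup hp} (hh : ∀ M, h • zeta F p M = zeta F p M)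
    (j : ℤ) : ι hp (TateDescent.W hp h) ^ j = 1 := by
  rw [TateDescent.W_apply, chi_eq_one_of_forall_smul_zeta hp hh, Units.val_one, map_one, ← ιHom_apply, map_one,
    one_zpow]

/-- `u_j(h) = 1` for `h ∈ ker χ`. [cite: Tate1967, §3.3] -/
theorem ι_W_zpow_eq_one_of_mem_ker {h : BaseGaloisGroup hp}
    (hh : h ∈ (BaseGaloisGroup.baseCyclotomicCharacter hp).ker) (j : ℤ) : ι hp (TateDescent.W hp h) ^ j = 1 := by
  rw [MonoidHom.mem_ker] at hh
  rw [TateDescent.W_apply, hh, Units.val_one, map_one, ← ιHom_apply, map_one, one_zpow]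

/-! ### Twisted cocycles trivial on `H` -/

/-- `C(1) = 0` for a twisted cocycle. [folklore] -/
private theorem apply_one
    (hC : ∀ g g' : BaseGaloisGroup hp, C (g * g') = C g + ι hp (TateDescent.W hp g) ^ j * (g • C g')) :
    C 1 = 0 := by
  have h := hC 1 1
  rw [one_mul, one_smul, map_one, ← ιHom_apply, map_one, one_zpow, one_mul] at h
  linear_combination (-1 : CompletedAlgClosure F) * h

/-- Right translation by `H` does not change a twisted cocycle trivial on `H`. [cite: Tate1967, §3.3] -/
theorem apply_mul_of_mem
    (hC : ∀ g g' : BaseGaloisGroup hp, C (g * g') = C g + ι hp (TateDescent.W hp g) ^ j * (g • C g'))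
    (hH : ∀ h : BaseGaloisGroup hp, (∀ M, h • zeta F p M = zeta F p M) → C h = 0)
    (g : BaseGaloisGroup hp) {k : BaseGaloisGroup hp} (hk : ∀ M, k • zeta F p M = zeta F p M) :
    C (g * k) = C g := by
  rw [hC, hH k hk, smul_zero, mul_zero, add_zero]

/-- **The values of a twisted cocycle trivial on `H` lie in `X = ℂ_F^H`.** [cite: Tate1967, §3.3 Theorem 2] -/
theorem mem_X
    (hC : ∀ g g' : BaseGaloisGroup hp, C (g * g') = C g + ι hp (TateDescent.W hp g) ^ j * (g • C g'))
    (hH : ∀ h : BaseGaloisGroup hp, (∀ M, h • zeta F p M = zeta F p M) → C h = 0) (g : BaseGaloisGroup hp) :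
    C g ∈ X hp := by
  rw [← fixedPoints_eq_X hp]
  intro h hh
  have h1 : C (h * g) = h • C g := by
    rw [hC, hH h hh, zero_add, ι_W_zpow_eq_one_of_forall_smul_zeta hp hh, one_mul]
  have h2 : C (h * g) = C g := by
    rw [show h * g = g * (g⁻¹ * h * g) by group]
    exact apply_mul_of_mem hp hC hH g (TateH1.conj_smul_zeta hp hh)
  rw [← h1, h2]

/-- `C(g g') = C(g' g)` for a twisted cocycle trivial on `H` (the commutator lies in `H`). [cite: Tate1967, §3.3] -/
theorem apply_mul_comm
    (hC : ∀ g g' : BaseGaloisGroup hp, C (g * g') = C g + ι hp (TateDescent.W hp g) ^ j * (g • C g'))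
    (hH : ∀ h : BaseGaloisGroup hp, (∀ M, h • zeta F p M = zeta F p M) → C h = 0) (g g' : BaseGaloisGroup hp) :
    C (g * g') = C (g' * g) := by
  rw [show g * g' = g' * g * (g⁻¹ * g'⁻¹ * g * g') by group]
  exact apply_mul_of_mem hp hC hH (g' * g) (TateH1.comm_smul_zeta hp g' g)

/-- **`u_j(γ) γ C(g) − C(g) = u_j(g) g C(γ) − C(γ)`** for a twisted cocycle trivial on `H` (both sides are
`C(γ g) − C(γ) − C(g) = C(g γ) − …`). [cite: Tate1967, §3.3 Theorem 2] -/
theorem twisted_smul_sub_eq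
    (hC : ∀ g g' : BaseGaloisGroup hp, C (g * g') = C g + ι hp (TateDescent.W hp g) ^ j * (g • C g'))
    (hH : ∀ h : BaseGaloisGroup hp, (∀ M, h • zeta F p M = zeta F p M) → C h = 0) (γ g : BaseGaloisGroup hp) :
    ι hp (TateDescent.W hp γ) ^ j * (γ • C g) - C g = ι hp (TateDescent.W hp g) ^ j * (g • C γ) - C γ := by
  have h1 := hC γ g
  have h2 := hC g γ
  rw [apply_mul_comm hp hC hH γ g] at h1
  linear_combination h1.symm.trans h2

/-! ### Twisted coboundaries -/

/-- **`C − ∂_j b` is again a twisted cocycle** (twisted coboundaries are twisted cocycles; the weights are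
multiplicative `G₀`-invariant scalars). [cite: Tate1967, §3.3] -/
theorem tcocycle_sub_tcoboundary
    (hC : ∀ g g' : BaseGaloisGroup hp, C (g * g') = C g + ι hp (TateDescent.W hp g) ^ j * (g • C g'))
    (b : CompletedAlgClosure F) (g g' : BaseGaloisGroup hp) :
    C (g * g') - (ι hp (TateDescent.W hp (g * g')) ^ j * ((g * g') • b) - b) =
      C g - (ι hp (TateDescent.W hp g) ^ j * (g • b) - b) +
        ι hp (TateDescent.W hp g) ^ j * (g • (C g' - (ι hp (TateDescent.W hp g') ^ j * (g' • b) - b))) := by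
  rw [hC, mul_smul, smul_sub, smul_sub, smul_mul', TateDescent.smul_ι_W_zpow, TateDescent.ι_W_zpow_mul]
  ring

/-- `C − ∂_j b` still vanishes on `H` when `b ∈ X` (`H` fixes `X`, `u_j = 1` on `H`). [cite: Tate1967, §3.3] -/
theorem sub_tcoboundary_apply_of_mem
    (hH : ∀ h : BaseGaloisGroup hp, (∀ M, h • zeta F p M = zeta F p M) → C h = 0)
    {b : CompletedAlgClosure F} (hb : b ∈ X hp) (h : BaseGaloisGroup hp) (hh : ∀ M, h • zeta F p M = zeta F p M) :
    C h - (ι hp (TateDescent.W hp h) ^ j * (h • b) - b) = 0 := by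
  have hfix : h • b = b := by
    have hb' := hb
    rw [← fixedPoints_eq_X hp] at hb'
    exact hb' h hh
  rw [hH h hh, hfix, ι_W_zpow_eq_one_of_forall_smul_zeta hp hh, one_mul, sub_self, sub_zero]

/-! ### The unconditional core: twisted cocycles trivial on `H` are twisted coboundaries -/

/-- **A twisted cocycle (`j ≠ 0`) trivial on `H` and vanishing at `γ = gen 3` is identically `0`**: by
`twisted_smul_sub_eq` every value `C(g) ∈ X` is fixed by the twisted operator `y ↦ u_j(γ) γ y` on `X`, which
has no non-zero fixed vector (uniqueness in `exists_unique_chi_zpow_mul_gen_smul_sub_eq`). [cite: Tate1967, §3.3 Theorem 2] -/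
theorem eq_zero_of_apply_gen_eq_zero (hj : j ≠ 0)
    (hC : ∀ g g' : BaseGaloisGroup hp, C (g * g') = C g + ι hp (TateDescent.W hp g) ^ j * (g • C g'))
    (hH : ∀ h : BaseGaloisGroup hp, (∀ M, h • zeta F p M = zeta F p M) → C h = 0)
    (hγ : C (gen hp 3) = 0) (g : BaseGaloisGroup hp) : C g = 0 := by
  have hfix : ι hp (TateDescent.W hp (gen hp 3)) ^ j * (gen hp 3 • C g) - C g = 0 := by
    rw [twisted_smul_sub_eq hp hC hH (gen hp 3) g, hγ, smul_zero, mul_zero, sub_zero]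
  have h0X : (0 : CompletedAlgClosure F) ∈ X hp := by
    simpa only [sub_self] using sub_mem_X hp (mem_X hp hC hH g) (mem_X hp hC hH g)
  have huniq := exists_unique_chi_zpow_mul_gen_smul_sub_eq hp (n := 3) le_rfl hj h0X
  have h0 : (0 : CompletedAlgClosure F) ∈ X hp ∧
      ι hp (PadicBase.ofPadicInt hp (BaseGaloisGroup.baseCyclotomicCharacter hp (gen hp 3) : ℤ_[p])) ^ j *
        (gen hp 3 • (0 : CompletedAlgClosure F)) - 0 = 0 := ⟨h0X, by rw [smul_zero, mul_zero, sub_zero]⟩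
  exact huniq.unique ⟨mem_X hp hC hH g, hfix⟩ h0

/-- **UNCONDITIONAL CORE — Tate 1967 §3.3 Theorem 2 over the tower `K₀(μ_{p^∞})`: a `χ^j`-twisted `1`-cocycle
(`j ≠ 0`) of `G₀ = Gal(F̄/K₀)` trivial on `H = Gal(F̄/K₀(μ_{p^∞}))` is a twisted coboundary `∂_j y` with
`y ∈ X`.** Solve `u_j(γ) γ y − y = C(γ)` in `X` (`exists_unique_chi_zpow_mul_gen_smul_sub_eq`, `γ = gen 3`),
subtract, and apply `eq_zero_of_apply_gen_eq_zero`. No continuity hypothesis. [cite: Tate1967, §3.3 Theorem 2]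
[cite: FontaineOuyang2022, §3.2 Prop. 3.17 and Thm. 3.21] -/
theorem eq_tcoboundary_of_forall_smul_zeta (hj : j ≠ 0)
    (hC : ∀ g g' : BaseGaloisGroup hp, C (g * g') = C g + ι hp (TateDescent.W hp g) ^ j * (g • C g'))
    (hH : ∀ h : BaseGaloisGroup hp, (∀ M, h • zeta F p M = zeta F p M) → C h = 0) :
    ∃ y ∈ X hp, ∀ g : BaseGaloisGroup hp, C g = ι hp (TateDescent.W hp g) ^ j * (g • y) - y := by
  obtain ⟨y, ⟨hy, hyγ⟩, -⟩ :=
    exists_unique_chi_zpow_mul_gen_smul_sub_eq hp (n := 3) le_rfl hj (mem_X hp hC hH (gen hp 3))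
  refine ⟨y, hy, fun g => ?_⟩
  set C₁ : BaseGaloisGroup hp → CompletedAlgClosure F :=
    fun g => C g - (ι hp (TateDescent.W hp g) ^ j * (g • y) - y) with hC₁
  have hC₁coc : ∀ g g' : BaseGaloisGroup hp,
      C₁ (g * g') = C₁ g + ι hp (TateDescent.W hp g) ^ j * (g • C₁ g') := fun g g' =>
    tcocycle_sub_tcoboundary hp hC y g g'
  have hC₁H : ∀ h : BaseGaloisGroup hp, (∀ M, h • zeta F p M = zeta F p M) → C₁ h = 0 := fun h hh =>
    sub_tcoboundary_apply_of_mem hp hH hy h hh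
  have hC₁γ : C₁ (gen hp 3) = 0 := by
    simp only [hC₁]
    rw [← TateDescent.W_apply] at hyγ
    rw [hyγ, sub_self]
  have := eq_zero_of_apply_gen_eq_zero hp hj hC₁coc hC₁H hC₁γ g
  simp only [hC₁] at this
  exact sub_eq_zero.mp this

/-! ### Granted (TS1): all continuous twisted cocycles -/

/-- **`H¹_cont(Gal(F̄/ℚ_p), ℂ_F(χ^j)) = 0` for `j ≠ 0`, GRANTED the Tate–Sen axiom (TS1) for `ℂ_F`** (Tate 1967
§3.3 Theorem 2 over the base `K₀ ≅ ℚ_p`): every continuous `χ^j`-twisted `1`-cocycle `C : G₀ → ℂ_F` is a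
twisted coboundary `u_j(g) g b − b`. On `ker χ` the weight is `1`, so `C|_{ker χ}` is an ordinary continuous
cocycle, `= ∂b₀` by `TateSen.baseKer_exists_eq_smul_sub_of_TS1` (edix-p4, hypothesis `hTS`); `C − ∂_j b₀` is
trivial on `H ⊆ ker χ` and the unconditional core applies. [cite: Tate1967, §3.2 Prop. 9–10 and §3.3 Theorem 2]
[cite: BergerColmez2008, Déf. 3.1.3 and Prop. 4.1.1] -/
theorem exists_eq_tcoboundary_of_TS1
    (hTS : ∃ K : ℝ, ∀ U : OpenSubgroup (BaseGaloisGroup.baseCyclotomicCharacter hp).ker,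
      ∃ α : CompletedAlgClosure F, (∀ u ∈ U, u • α = α) ∧ ‖α‖ ≤ K ∧
        ∑ᶠ q : (BaseGaloisGroup.baseCyclotomicCharacter hp).ker ⧸ U.toSubgroup, q.out • α = 1)
    (hj : j ≠ 0)
    (hC : ∀ g g' : BaseGaloisGroup hp, C (g * g') = C g + ι hp (TateDescent.W hp g) ^ j * (g • C g'))
    (hcont : Continuous C) :
    ∃ b : CompletedAlgClosure F, ∀ g : BaseGaloisGroup hp, C g = ι hp (TateDescent.W hp g) ^ j * (g • b) - b := by
  -- (1) trivialise `C` on `ker χ`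
  obtain ⟨b₀, hb₀⟩ := TateSen.baseKer_exists_eq_smul_sub_of_TS1 hp hTS
    (fun h : (BaseGaloisGroup.baseCyclotomicCharacter hp).ker => C h)
    (fun g h => by
      change C ((g : BaseGaloisGroup hp) * h) = C g + (g : BaseGaloisGroup hp) • C h
      rw [hC, ι_W_zpow_eq_one_of_mem_ker hp g.2, one_mul])
    (hcont.comp continuous_subtype_val)
  set C₁ : BaseGaloisGroup hp → CompletedAlgClosure F :=
    fun g => C g - (ι hp (TateDescent.W hp g) ^ j * (g • b₀) - b₀) with hC₁
  have hC₁coc : ∀ g g' : BaseGaloisGroup hp,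
      C₁ (g * g') = C₁ g + ι hp (TateDescent.W hp g) ^ j * (g • C₁ g') := fun g g' =>
    tcocycle_sub_tcoboundary hp hC b₀ g g'
  have hC₁H : ∀ h : BaseGaloisGroup hp, (∀ M, h • zeta F p M = zeta F p M) → C₁ h = 0 := by
    intro h hh
    have hker : h ∈ (BaseGaloisGroup.baseCyclotomicCharacter hp).ker := by
      rw [MonoidHom.mem_ker]; exact chi_eq_one_of_forall_smul_zeta hp hh
    have := hb₀ ⟨h, hker⟩
    change C h = h • b₀ - b₀ at this
    simp only [hC₁, this, ι_W_zpow_eq_one_of_forall_smul_zeta hp hh, one_mul, sub_self]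
  -- (2) the core
  obtain ⟨y, -, hy⟩ := eq_tcoboundary_of_forall_smul_zeta hp hj hC₁coc hC₁H
  refine ⟨y + b₀, fun g => ?_⟩
  have := hy g
  simp only [hC₁] at this
  rw [smul_add, mul_add]
  linear_combination this

/-- The `G₀`-level vanishing in the input shape of the transfer `TateDescent.exists_eq_twistedCoboundary_of_base`
(any `ℓ`, coefficient `a = 0`), GRANTED (TS1). [cite: Tate1967, §3.3 Theorem 2] -/
theorem base_hG_of_TS1
    (hTS : ∃ K : ℝ, ∀ U : OpenSubgroup (BaseGaloisGroup.baseCyclotomicCharacter hp).ker,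
      ∃ α : CompletedAlgClosure F, (∀ u ∈ U, u • α = α) ∧ ‖α‖ ≤ K ∧
        ∑ᶠ q : (BaseGaloisGroup.baseCyclotomicCharacter hp).ker ⧸ U.toSubgroup, q.out • α = 1)
    (hj : j ≠ 0) (ℓ : BaseGaloisGroup hp → CompletedAlgClosure F) (C : BaseGaloisGroup hp → CompletedAlgClosure F)
    (hC : ∀ g g' : BaseGaloisGroup hp, C (g * g') = C g + ι hp (TateDescent.W hp g) ^ j * (g • C g'))
    (hcont : Continuous C) :
    ∃ (b : CompletedAlgClosure F) (a : PadicBase F p hp), ∀ g : BaseGaloisGroup hp,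
      C g = ι hp (TateDescent.W hp g) ^ j * (g • b) - b + ι hp a * ℓ g := by
  obtain ⟨b, hb⟩ := exists_eq_tcoboundary_of_TS1 hp hTS hj hC hcont
  exact ⟨b, 0, fun g => by rw [hb g, ← ιHom_apply (hp := hp) 0, map_zero, zero_mul, add_zero]⟩

/-! ### Over `F`: `H¹_cont(Γ_F, ℂ_F(χ_F^j)) = 0` -/

/-- The weight at `toBase σ` is `χ_F(σ)^j` read in `ℂ_F`: `ι(W(toBase σ)) = χ_F(σ)` through `ℤ_p → ℚ_p → F → ℂ_F`
(`χ(toBase σ) = χ_F(σ)`, tree `BaseGaloisGroup.baseCyclotomicCharacter_toBase`). [cite: Tate1967, §3.3] -/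
theorem ι_W_toBase (σ : absoluteGaloisGroup F) :
    ι hp (TateDescent.W hp (BaseGaloisGroup.toBase hp σ)) = algebraMap F (CompletedAlgClosure F)
      (LocalField.padicRingHom F p hp (((GaloisRep.cyclotomicCharacter F p σ : ℤ_[p]ˣ) : ℤ_[p]) : ℚ_[p])) := by
  rw [TateDescent.W_apply, BaseGaloisGroup.baseCyclotomicCharacter_toBase, PadicBase.ofPadicInt_apply,
    ι_toPadic_symm]

variable {c : absoluteGaloisGroup F → CompletedAlgClosure F}

/-- **Tate 1967 §3.3 Theorem 2 over `F`, GRANTED (TS1): `H¹_cont(Γ_F, ℂ_F(χ_F^j)) = 0` for `j ≠ 0`** — every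
continuous `χ_F^j`-twisted `1`-cocycle `c : Γ_F → ℂ_F` (`c(στ) = c(σ) + u_j(σ) σ c(τ)`, weight
`u_j(σ) = ι(W(toBase σ))^j = χ_F(σ)^j`) is a twisted coboundary `σ ↦ u_j(σ) σ B − B`. The `G₀`-vanishing
(`exists_eq_tcoboundary_of_TS1`) transferred along `Γ_F ≤ G₀` by `TateDescent.exists_eq_twistedCoboundary_of_base`
(edix-p2) with `ℓ = 0`. CONDITIONAL on (TS1) only. [cite: Tate1967, §3.3 Theorem 2]
[cite: FontaineOuyang2022, §3.2 Thm. 3.21] -/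
theorem exists_eq_tcoboundary_absGalois_of_TS1
    (hTS : ∃ K : ℝ, ∀ U : OpenSubgroup (BaseGaloisGroup.baseCyclotomicCharacter hp).ker,
      ∃ α : CompletedAlgClosure F, (∀ u ∈ U, u • α = α) ∧ ‖α‖ ≤ K ∧
        ∑ᶠ q : (BaseGaloisGroup.baseCyclotomicCharacter hp).ker ⧸ U.toSubgroup, q.out • α = 1)
    (hj : j ≠ 0)
    (hc : ∀ σ τ : absoluteGaloisGroup F,
      c (σ * τ) = c σ + ι hp (TateDescent.W hp (BaseGaloisGroup.toBase hp σ)) ^ j * (σ • c τ))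
    (hcont : Continuous c) :
    ∃ B : CompletedAlgClosure F, ∀ σ : absoluteGaloisGroup F,
      c σ = ι hp (TateDescent.W hp (BaseGaloisGroup.toBase hp σ)) ^ j * (σ • B) - B := by
  obtain ⟨B, A, h⟩ := TateDescent.exists_eq_twistedCoboundary_of_base hp j (fun _ => 0)
    (fun C hC hCc => base_hG_of_TS1 hp hTS hj _ C hC hCc) hc hcont
  exact ⟨B, fun σ => by rw [h σ, mul_zero, add_zero]⟩

/-- The same with the weight written as `χ_F(σ)^j` (`GaloisRep.cyclotomicCharacter F p`, read in `ℂ_F` through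
`ℤ_p → ℚ_p → F → ℂ_F`). [cite: Tate1967, §3.3 Theorem 2] -/
theorem exists_eq_tcoboundary_absGalois_of_TS1'
    (hTS : ∃ K : ℝ, ∀ U : OpenSubgroup (BaseGaloisGroup.baseCyclotomicCharacter hp).ker,
      ∃ α : CompletedAlgClosure F, (∀ u ∈ U, u • α = α) ∧ ‖α‖ ≤ K ∧
        ∑ᶠ q : (BaseGaloisGroup.baseCyclotomicCharacter hp).ker ⧸ U.toSubgroup, q.out • α = 1)
    (hj : j ≠ 0)
    (hc : ∀ σ τ : absoluteGaloisGroup F,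
      c (σ * τ) = c σ + algebraMap F (CompletedAlgClosure F) (LocalField.padicRingHom F p hp
        (((GaloisRep.cyclotomicCharacter F p σ : ℤ_[p]ˣ) : ℤ_[p]) : ℚ_[p])) ^ j * (σ • c τ))
    (hcont : Continuous c) :
    ∃ B : CompletedAlgClosure F, ∀ σ : absoluteGaloisGroup F,
      c σ = algebraMap F (CompletedAlgClosure F) (LocalField.padicRingHom F p hp
        (((GaloisRep.cyclotomicCharacter F p σ : ℤ_[p]ˣ) : ℤ_[p]) : ℚ_[p])) ^ j * (σ • B) - B := by
  simp only [← ι_W_toBase hp] at hc ⊢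
  exact exists_eq_tcoboundary_absGalois_of_TS1 hp hTS hj hc hcont

end TateTwistedH1

end Literature.NumberTheory.PAdicHodge

end
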